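/-
Copyright (c) 2026 the pub-hodgecm-mathlib formalisation cell (harness21).  Prover seat hodgecm-mathlib-K2E1-p07 (g2), Track B «K2-LIT», h413;
DOCKING EDITION of the (H1) package asked by K2E1-p05 (g2) (`K2/STATUS.md` 2026-09-03T22:59:14Z, option (α)).  2026-09-03.
-/
import Summits.HodgeConjecture.HodgeConjecture.Theorems.K2E1PoincareSeriesH1Package   -- ★ p855471 (this seat): `family_translate`, `family_invariant`, linearity
import HarnessLib

/-!
# K2_E1 road (h413 = stmt-HodgeConjecture-24833), 5R route S2 — the (H1) package with the TEST FUNCTION EXPOSED (docking edition for (H2)):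
# `∃ f_∞ φ, φ = c_u ⊗ ⊗_{w ≠ v} 𝟙_{U(H)(𝒪_w)} ⊗ f_∞ ∧ φ|_{U(H)(L⁺) ∖ 1} = 0 ∧ P_φ ≠ 0 ∧ R_v(e) P_φ = P_φ ∧ P_φ` is `U(H)(𝒪_w)`-fixed off `v`

Cell `pub/hodgecm-mathlib` (D-0151), Track B; companion of ★ p855471 `K2E1PoincareSeriesH1Package` (whose `exists_h1Package` hides the test function behind
`∃ F`), written at the request of K2E1-p05 (g2) (`K2/STATUS.md` 2026-09-03T22:59:14Z, option (α)) so that the (H2) head ★ p855440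
`K2E1PoincareSeriesCuspidal.toLp_poincare_mem_cuspidalSubspace` — which takes a NAMED `φ : C_c(U(H)(𝔸), ℂ)` with adelic cusp-vanishing and concludes
`h.toLp (fiberIntegralVec … Measure.count φ) ∈ L²_cusp` for every `MemLp` witness `h` — docks on the SAME vector `F`.  THEOREMS ONLY; lane
`--supports stmt-HodgeConjecture-24833 --as helper` (count-neutral).

* `awayFactor_mul_jhom_mul` — `Ψ_f(x · j_v(g) · y) = Ψ_f(x · y)` (middle invariance of the away-from-`v` factor, for the cusp-vanishing integrals
  `∫_{N_v} φ(x u⁻¹ y) du` of (H2): with `toLocal_mul_jhom_mul`, `φ(x · j_v(g) · y) = Ψ_f(x y) · c(x_v g y_v)`, so the `N_v`-integral factors through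
  the local coefficient `c_u`);
* **`exists_h1Package_poincare`**: in the frame of ★ p855471 (CM field `L`, `H ∈ M_N(L)`, place `v`, supercuspidal `ρ` with compact centre, invariant
  `B`, `u ≠ 0`, idempotent `e`, automorphic `μH`, canonical place embeddings `j_w`) there are an archimedean factor `f` (continuous, compactly supported,
  `f(1) = 1`) and `φ ∈ C_c(U(H)(𝔸_{L⁺}), ℂ)` with the FACTORISATION `φ(y) = Ψ_f(y) · B (ρ y_v u) u` (`φ = c_u ⊗ ⊗_{w≠v} 𝟙_{U(H)(𝒪_w)} ⊗ f`, `c_u = λ e`),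
  `φ(γ) = 0` for every `γ ∈ U(H)(L⁺) ∖ {1}`, and for the EXPLICIT vector
  `F := (memLp_fiberIntegralVec_quotientSubgroup (cmDatum L N H) μH Measure.count φ 2).toLp (P_φ)` (★ rung 1): `F ≠ 0`, `R_v(e) F = F`, and
  `R(j_w k) F = F` for all `k ∈ U(H)(𝒪_w)`, `w ≠ v`.  Proof = the construction of ★ p855471 (`T : x ↦ P_{φ_x}` linear intertwiner; ★ p855188;
  ★ p855444 `exists_archFactor_vanishing`) with the witnesses kept.

HONEST LABEL: HC_CM is proved only modulo the 7 printed citations (2 remaining named inputs: hLiu418 = stmt-HodgeConjecture-24832,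
h413 = stmt-HodgeConjecture-24833) until rung 0 closes; this file is a `--supports stmt-HodgeConjecture-24833` helper and retires nothing by itself.

## References
* [Gelbart1975] S. Gelbart, *Automorphic forms on adele groups*, Ann. of Math. Stud. 83 (1975), §10 p. 153.
* [Rogawski1990] J. D. Rogawski, *Automorphic Representations of Unitary Groups in Three Variables*, Ann. of Math. Stud. 123 (1990), §13.8 p. 218 (i)–(iii).
* [BorelJacquet1979] A. Borel, H. Jacquet, PSPM 33.1 (1979), §4.1.
-/

set_option autoImplicit false
-- justification (lint debt, as in every sibling `K2E1*` file): the mandated namespace `Summit.HodgeConjecture.HodgeConjecture.…` repeats a component.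
set_option linter.dupNamespace false

noncomputable section

open MeasureTheory Filter Topology CompactlySupported NumberField IsDedekindDomain
open scoped ComplexConjugate Classical
open Literature.NumberTheory.Automorphic Literature.NumberTheory.Automorphic.UnitaryGroup Representation
open Summit.HodgeConjecture.HodgeConjecture.Cruxes.H413.K2E1PoincareSeriesCompactSupport
open Summit.HodgeConjecture.HodgeConjecture.Cruxes.H413.K2E1PoincareSeriesTestFunctions
open Summit.HodgeConjecture.HodgeConjecture.Cruxes.H413.K2E1SupercuspidalIdempotent
open Summit.HodgeConjecture.HodgeConjecture.Cruxes.H413.K2E1PoincareSeriesH1Package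

namespace Summit.HodgeConjecture.HodgeConjecture.Cruxes.H413.K2E1PoincareSeriesH1PackagePoincare

section H1

variable (L : Type) [Field L] [NumberField L] [IsCMField L] {N : ℕ} (H : Matrix (Fin N) (Fin N) L)
  (v : HeightOneSpectrum (𝓞 ↥(maximalRealSubfield L)))

/-- `(x · j_v(g) · y)_v = x_v · g · y_v`. [cite: BorelJacquet1979, §4.1] -/
theorem toLocal_mul_jhom_mul (g : (cmDatum L N H).Local v) (x y : (cmDatum L N H).Adelic) :
    (cmDatum L N H).toLocal v (x * (((MonoidHom.id ((cmDatum L N H).Adelic)).comp ((inclPlaceAdelic (↥(maximalRealSubfield L)) L (IsCMField.complexConj L) N H v).comp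
        (localPiEquiv L (IsCMField.complexConj L) N H v).symm.toMulEquiv.toMonoidHom)).comp (MonoidHom.id ((cmDatum L N H).Local v))) g * y) = (cmDatum L N H).toLocal v x * g * (cmDatum L N H).toLocal v y := by
  rw [map_mul, map_mul, toLocal_jhom_self]

/-- **`Ψ_f(x · j_v(g) · y) = Ψ_f(x · y)`** — the away-from-`v` factor does not see the `v`-coordinate in the middle either (coordinates off `v` and at
infinity are multiplicative and those of `j_v g` are trivial); with `toLocal_mul_jhom_mul` this makes the cusp-vanishing integrals `∫_{N_v} φ(x u⁻¹ y) du`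
of (H2) factor through the local coefficient. [cite: BorelJacquet1979, §4.1] -/
theorem awayFactor_mul_jhom_mul (f : arch (↥(maximalRealSubfield L)) L (IsCMField.complexConj L) N H → ℂ)
    (g : (cmDatum L N H).Local v) (x y : (cmDatum L N H).Adelic) :
    (if ∀ w, w ≠ v → (cmDatum L N H).toLocal w (x * (((MonoidHom.id ((cmDatum L N H).Adelic)).comp ((inclPlaceAdelic (↥(maximalRealSubfield L)) L (IsCMField.complexConj L) N H v).comp
        (localPiEquiv L (IsCMField.complexConj L) N H v).symm.toMulEquiv.toMonoidHom)).comp (MonoidHom.id ((cmDatum L N H).Local v))) g * y) ∈ cmLocalIntegralLevel L N H w then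
          f (UnitaryGroup.archPart (↥(maximalRealSubfield L)) L (IsCMField.complexConj L) N H (x * (((MonoidHom.id ((cmDatum L N H).Adelic)).comp ((inclPlaceAdelic (↥(maximalRealSubfield L)) L (IsCMField.complexConj L) N H v).comp
        (localPiEquiv L (IsCMField.complexConj L) N H v).symm.toMulEquiv.toMonoidHom)).comp (MonoidHom.id ((cmDatum L N H).Local v))) g * y)) else 0) =
      (if ∀ w, w ≠ v → (cmDatum L N H).toLocal w (x * y) ∈ cmLocalIntegralLevel L N H w then
          f (UnitaryGroup.archPart (↥(maximalRealSubfield L)) L (IsCMField.complexConj L) N H (x * y)) else 0) := by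
  have hcoord : ∀ w, w ≠ v → (cmDatum L N H).toLocal w (x * (((MonoidHom.id ((cmDatum L N H).Adelic)).comp ((inclPlaceAdelic (↥(maximalRealSubfield L)) L (IsCMField.complexConj L) N H v).comp
        (localPiEquiv L (IsCMField.complexConj L) N H v).symm.toMulEquiv.toMonoidHom)).comp (MonoidHom.id ((cmDatum L N H).Local v))) g * y) = (cmDatum L N H).toLocal w (x * y) := fun w hw => by
    rw [map_mul, map_mul, toLocal_jhom_of_ne L H hw, mul_one, map_mul]
  have harch : UnitaryGroup.archPart (↥(maximalRealSubfield L)) L (IsCMField.complexConj L) N H (x * (((MonoidHom.id ((cmDatum L N H).Adelic)).comp ((inclPlaceAdelic (↥(maximalRealSubfield L)) L (IsCMField.complexConj L) N H v).comp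
        (localPiEquiv L (IsCMField.complexConj L) N H v).symm.toMulEquiv.toMonoidHom)).comp (MonoidHom.id ((cmDatum L N H).Local v))) g * y) = UnitaryGroup.archPart (↥(maximalRealSubfield L)) L (IsCMField.complexConj L) N H (x * y) := by
    have h2 : UnitaryGroup.archPart (↥(maximalRealSubfield L)) L (IsCMField.complexConj L) N H (x * (((MonoidHom.id ((cmDatum L N H).Adelic)).comp ((inclPlaceAdelic (↥(maximalRealSubfield L)) L (IsCMField.complexConj L) N H v).comp
        (localPiEquiv L (IsCMField.complexConj L) N H v).symm.toMulEquiv.toMonoidHom)).comp (MonoidHom.id ((cmDatum L N H).Local v))) g) = UnitaryGroup.archPart (↥(maximalRealSubfield L)) L (IsCMField.complexConj L) N H x := by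
      have h := (UnitaryGroup.archPart (↥(maximalRealSubfield L)) L (IsCMField.complexConj L) N H).map_mul x ((((MonoidHom.id ((cmDatum L N H).Adelic)).comp ((inclPlaceAdelic (↥(maximalRealSubfield L)) L (IsCMField.complexConj L) N H v).comp
        (localPiEquiv L (IsCMField.complexConj L) N H v).symm.toMulEquiv.toMonoidHom)).comp (MonoidHom.id ((cmDatum L N H).Local v))) g)
      rw [archPart_jhom, mul_one] at h
      exact h
    have h1 : UnitaryGroup.archPart (↥(maximalRealSubfield L)) L (IsCMField.complexConj L) N H (x * (((MonoidHom.id ((cmDatum L N H).Adelic)).comp ((inclPlaceAdelic (↥(maximalRealSubfield L)) L (IsCMField.complexConj L) N H v).comp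
        (localPiEquiv L (IsCMField.complexConj L) N H v).symm.toMulEquiv.toMonoidHom)).comp (MonoidHom.id ((cmDatum L N H).Local v))) g * y) = UnitaryGroup.archPart (↥(maximalRealSubfield L)) L (IsCMField.complexConj L) N H (x * (((MonoidHom.id ((cmDatum L N H).Adelic)).comp ((inclPlaceAdelic (↥(maximalRealSubfield L)) L (IsCMField.complexConj L) N H v).comp
        (localPiEquiv L (IsCMField.complexConj L) N H v).symm.toMulEquiv.toMonoidHom)).comp (MonoidHom.id ((cmDatum L N H).Local v))) g) * UnitaryGroup.archPart (↥(maximalRealSubfield L)) L (IsCMField.complexConj L) N H y :=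
      (UnitaryGroup.archPart (↥(maximalRealSubfield L)) L (IsCMField.complexConj L) N H).map_mul _ _
    have h3 : UnitaryGroup.archPart (↥(maximalRealSubfield L)) L (IsCMField.complexConj L) N H (x * y) = UnitaryGroup.archPart (↥(maximalRealSubfield L)) L (IsCMField.complexConj L) N H x * UnitaryGroup.archPart (↥(maximalRealSubfield L)) L (IsCMField.complexConj L) N H y := (UnitaryGroup.archPart (↥(maximalRealSubfield L)) L (IsCMField.complexConj L) N H).map_mul _ _
    rw [h1, h2, h3]
  rw [harch]
  have hiff : (∀ w, w ≠ v → (cmDatum L N H).toLocal w (x * (((MonoidHom.id ((cmDatum L N H).Adelic)).comp ((inclPlaceAdelic (↥(maximalRealSubfield L)) L (IsCMField.complexConj L) N H v).comp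
        (localPiEquiv L (IsCMField.complexConj L) N H v).symm.toMulEquiv.toMonoidHom)).comp (MonoidHom.id ((cmDatum L N H).Local v))) g * y) ∈ cmLocalIntegralLevel L N H w) ↔
      ∀ w, w ≠ v → (cmDatum L N H).toLocal w (x * y) ∈ cmLocalIntegralLevel L N H w :=
    forall₂_congr fun w hw => by rw [hcoord w hw]
  by_cases h : ∀ w, w ≠ v → (cmDatum L N H).toLocal w (x * y) ∈ cmLocalIntegralLevel L N H w
  · rw [if_pos h, if_pos (hiff.2 h)]
  · rw [if_neg h, if_neg (fun h' => h (hiff.1 h'))]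

variable {V : Type} [AddCommGroup V] [Module ℂ V] {ρ : Representation ℂ ((cmDatum L N H).Local v) V} {B : V →ₗ⋆[ℂ] V →ₗ[ℂ] ℂ}
  (hBinv : ∀ (g : (cmDatum L N H).Local v) (x y : V), B (ρ g x) (ρ g y) = B x y) {u : V}
  [MeasurableSpace (cmDatum L N H).Adelic] [BorelSpace (cmDatum L N H).Adelic]
  (μH : Measure (cmDatum L N H).automorphicQuotient) [(cmDatum L N H).IsAutomorphicMeasure μH]
  [NonarchimedeanGroup ((cmDatum L N H).Local v)] [LocallyCompactSpace ((cmDatum L N H).Local v)] [T2Space ((cmDatum L N H).Local v)]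
  [MeasurableSpace ((cmDatum L N H).Local v)] [BorelSpace ((cmDatum L N H).Local v)]
  [ρ.IsIrreducible] (hadm : ρ.IsAdmissible) (hsc : ρ.IsSupercuspidal)
  (hZ : IsCompact (Subgroup.center ((cmDatum L N H).Local v) : Set ((cmDatum L N H).Local v)))
  (hBsymm : B.IsSymm) (hBpos : ∀ x : V, x ≠ 0 → 0 < (B x x).re)
  (ν : Measure ((cmDatum L N H).Local v)) [ν.IsHaarMeasure] [ν.IsInvInvariant] (hu : u ≠ 0)
  (e : C_c((cmDatum L N H).Local v, ℂ)) (he : ∀ g, e g = ((((∫ y, ‖B (ρ y u) u‖ ^ 2 ∂ν) / (B u u).re : ℝ) : ℂ))⁻¹ * B (ρ g u) u)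

include hadm hsc hZ hBsymm hBpos hBinv hu he in
/-- **The (H1) package with the test function exposed** (docking edition; see the module docstring): `∃ f φ`, `f` a continuous compactly
supported archimedean factor with `f(1) = 1`, `φ = c_u ⊗ ⊗_{w ≠ v} 𝟙_{U(H)(𝒪_w)} ⊗ f ∈ C_c(U(H)(𝔸_{L⁺}))` (as the pointwise FACTORISATION
`φ(y) = Ψ_f(y) · B (ρ y_v u) u`), `φ(γ) = 0` on `U(H)(L⁺) ∖ {1}`, and for `F := (memLp_fiberIntegralVec_quotientSubgroup … φ 2).toLp (P_φ)`: `F ≠ 0`,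
`R_v(e) F = F`, `R(j_w k) F = F` for `k ∈ U(H)(𝒪_w)`, `w ≠ v`. [cite: Gelbart1975, §10 p. 153] [cite: Rogawski1990, §13.8 p. 218 (i)–(iii)] -/
theorem exists_h1Package_poincare
    (hjv : Continuous
      (((MonoidHom.id ((cmDatum L N H).Adelic)).comp ((inclPlaceAdelic (↥(maximalRealSubfield L)) L (IsCMField.complexConj L) N H v).comp
        (localPiEquiv L (IsCMField.complexConj L) N H v).symm.toMulEquiv.toMonoidHom)).comp (MonoidHom.id ((cmDatum L N H).Local v)))) :
    haveI := discreteTopology_quotientSubgroup_of_center'_eq_bot (cmDatum L N H) rfl (cmDatum_isDiscreteRational L N H)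
    haveI := countable_quotientSubgroup_of_center'_eq_bot (cmDatum L N H) rfl (cmDatum_isDiscreteRational L N H)
    haveI : IsClosed (((cmDatum L N H).quotientSubgroup : Subgroup (cmDatum L N H).Adelic) : Set (cmDatum L N H).Adelic) :=
      isClosed_quotientSubgroup_of_center'_eq_bot (cmDatum L N H) rfl (cmDatum_isDiscreteRational L N H)
    haveI : IsFiniteMeasureOnCompacts (Measure.count : Measure (cmDatum L N H).quotientSubgroup) :=
      ⟨fun _ hK => Measure.count_apply_lt_top.2 hK.finite_of_discrete⟩
    letI := (cmDatum L N H).measurableSpaceQuotientForm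
    haveI := (cmDatum L N H).borelSpaceQuotientForm
    ∃ (f : arch (↥(maximalRealSubfield L)) L (IsCMField.complexConj L) N H → ℂ) (φ : C_c((cmDatum L N H).Adelic, ℂ)),
      Continuous f ∧ HasCompactSupport f ∧ f 1 = 1 ∧
      (∀ y : (cmDatum L N H).Adelic, φ y = (if ∀ w, w ≠ v → (cmDatum L N H).toLocal w y ∈ cmLocalIntegralLevel L N H w then
          f (UnitaryGroup.archPart (↥(maximalRealSubfield L)) L (IsCMField.complexConj L) N H y) else 0) * B (ρ ((cmDatum L N H).toLocal v y) u) u) ∧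
      (∀ γ : (cmDatum L N H).Adelic, γ ∈ (cmDatum L N H).quotientSubgroup → γ ≠ 1 → φ γ = 0) ∧
      (memLp_fiberIntegralVec_quotientSubgroup (cmDatum L N H) μH (Measure.count : Measure (cmDatum L N H).quotientSubgroup) φ 2).toLp _ ≠ 0 ∧
      (((cmDatum L N H).rightRegular μH).restrict
          (((MonoidHom.id ((cmDatum L N H).Adelic)).comp ((inclPlaceAdelic (↥(maximalRealSubfield L)) L (IsCMField.complexConj L) N H v).comp
        (localPiEquiv L (IsCMField.complexConj L) N H v).symm.toMulEquiv.toMonoidHom)).comp (MonoidHom.id ((cmDatum L N H).Local v)))).integratedOperator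
        (((cmDatum L N H).isUnitary_rightRegular μH).restrict
          (((MonoidHom.id ((cmDatum L N H).Adelic)).comp ((inclPlaceAdelic (↥(maximalRealSubfield L)) L (IsCMField.complexConj L) N H v).comp
        (localPiEquiv L (IsCMField.complexConj L) N H v).symm.toMulEquiv.toMonoidHom)).comp (MonoidHom.id ((cmDatum L N H).Local v))))
        (((cmDatum L N H).isStronglyContinuous_rightRegular_holds μH).restrict
          (((MonoidHom.id ((cmDatum L N H).Adelic)).comp ((inclPlaceAdelic (↥(maximalRealSubfield L)) L (IsCMField.complexConj L) N H v).comp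
        (localPiEquiv L (IsCMField.complexConj L) N H v).symm.toMulEquiv.toMonoidHom)).comp (MonoidHom.id ((cmDatum L N H).Local v))) hjv) ν e
        ((memLp_fiberIntegralVec_quotientSubgroup (cmDatum L N H) μH (Measure.count : Measure (cmDatum L N H).quotientSubgroup) φ 2).toLp _) =
        (memLp_fiberIntegralVec_quotientSubgroup (cmDatum L N H) μH (Measure.count : Measure (cmDatum L N H).quotientSubgroup) φ 2).toLp _ ∧
      ∀ w, w ≠ v → ∀ k ∈ cmLocalIntegralLevel L N H w, (cmDatum L N H).rightRegular μH
            ((((MonoidHom.id ((cmDatum L N H).Adelic)).comp ((inclPlaceAdelic (↥(maximalRealSubfield L)) L (IsCMField.complexConj L) N H w).comp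
        (localPiEquiv L (IsCMField.complexConj L) N H w).symm.toMulEquiv.toMonoidHom)).comp (MonoidHom.id ((cmDatum L N H).Local w))) k)
          ((memLp_fiberIntegralVec_quotientSubgroup (cmDatum L N H) μH (Measure.count : Measure (cmDatum L N H).quotientSubgroup) φ 2).toLp _) =
          (memLp_fiberIntegralVec_quotientSubgroup (cmDatum L N H) μH (Measure.count : Measure (cmDatum L N H).quotientSubgroup) φ 2).toLp _ := by
  have hdisc : (cmDatum L N H).IsDiscreteRational := cmDatum_isDiscreteRational L N H
  haveI := discreteTopology_quotientSubgroup_of_center'_eq_bot (cmDatum L N H) rfl hdisc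
  haveI := countable_quotientSubgroup_of_center'_eq_bot (cmDatum L N H) rfl hdisc
  haveI : IsClosed (((cmDatum L N H).quotientSubgroup : Subgroup (cmDatum L N H).Adelic) : Set (cmDatum L N H).Adelic) :=
    isClosed_quotientSubgroup_of_center'_eq_bot (cmDatum L N H) rfl hdisc
  haveI : IsFiniteMeasureOnCompacts (Measure.count : Measure (cmDatum L N H).quotientSubgroup) :=
    ⟨fun _ hK => Measure.count_apply_lt_top.2 hK.finite_of_discrete⟩
  letI := (cmDatum L N H).measurableSpaceQuotientForm
  haveI := (cmDatum L N H).borelSpaceQuotientForm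
  have hsm : ρ.IsSmooth := hadm.isSmooth
  have hcc : ∀ x : V, Continuous fun g : (cmDatum L N H).Local v => B (ρ g u) x := fun x =>
    continuous_sesqForm_apply_apply' hBsymm (hsm u) x
  have hccs : ∀ x : V, HasCompactSupport fun g : (cmDatum L N H).Local v => B (ρ g u) x := fun x =>
    hsc.hasCompactSupport_sesqForm_apply_apply' hZ hsm hBinv u x
  obtain ⟨f, hfc, hfs, hf1, hvan⟩ := exists_archFactor_vanishing L H v (hcc u) (hccs u)
  choose φ hφ using fun x : V => exists_toCc_singleTensor L H v (hcc x) (hccs x) hfc hfs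
  have hφ' : ∀ (x : V) (z : (cmDatum L N H).Adelic), φ x z = (if ∀ w, w ≠ v → (cmDatum L N H).toLocal w z ∈ cmLocalIntegralLevel L N H w then
          f (UnitaryGroup.archPart (↥(maximalRealSubfield L)) L (IsCMField.complexConj L) N H z) else 0) * B (ρ ((cmDatum L N H).toLocal v z) u) x := hφ
  have hP : ∀ x : V, MemLp (fiberIntegralVec (cmDatum L N H).quotientSubgroup (Measure.count : Measure (cmDatum L N H).quotientSubgroup) (⇑(φ x)) : (cmDatum L N H).automorphicQuotient → ℂ) 2 μH := fun x =>
    memLp_fiberIntegralVec_quotientSubgroup (cmDatum L N H) μH Measure.count (φ x) 2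
  let T : V →ₗ[ℂ] (cmDatum L N H).L2 μH :=
    { toFun := fun x => (hP x).toLp _
      map_add' := fun x y => by
        refine Lp.ext_iff.2 ?_
        have h2 : (fiberIntegralVec (cmDatum L N H).quotientSubgroup (Measure.count : Measure (cmDatum L N H).quotientSubgroup) (⇑(φ (x + y))) : (cmDatum L N H).automorphicQuotient → ℂ) =ᵐ[μH] fiberIntegralVec (cmDatum L N H).quotientSubgroup (Measure.count : Measure (cmDatum L N H).quotientSubgroup) (⇑(φ x)) + fiberIntegralVec (cmDatum L N H).quotientSubgroup (Measure.count : Measure (cmDatum L N H).quotientSubgroup) (⇑(φ y)) :=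
          Eventually.of_forall fun q => congrFun (fiberIntegralVec_family_add L H v φ hφ' x y) q
        exact (hP (x + y)).coeFn_toLp.trans (h2.trans (((hP x).coeFn_toLp.symm.add (hP y).coeFn_toLp.symm).trans (Lp.coeFn_add _ _).symm))
      map_smul' := fun a x => by
        refine Lp.ext_iff.2 ?_
        have h2 : (fiberIntegralVec (cmDatum L N H).quotientSubgroup (Measure.count : Measure (cmDatum L N H).quotientSubgroup) (⇑(φ (a • x))) : (cmDatum L N H).automorphicQuotient → ℂ) =ᵐ[μH] a • fiberIntegralVec (cmDatum L N H).quotientSubgroup (Measure.count : Measure (cmDatum L N H).quotientSubgroup) (⇑(φ x)) :=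
          Eventually.of_forall fun q => congrFun (fiberIntegralVec_family_smul L H v φ hφ' a x) q
        exact (hP (a • x)).coeFn_toLp.trans (h2.trans (((hP x).coeFn_toLp.symm.const_smul a).trans (Lp.coeFn_smul _ _).symm)) }
  have hT : ∀ x, T x = (hP x).toLp _ := fun _ => rfl
  have hinter : ∀ (h : (cmDatum L N H).Local v) (x : V), T (ρ h x) =
      (((cmDatum L N H).rightRegular μH).restrict
        (((MonoidHom.id ((cmDatum L N H).Adelic)).comp ((inclPlaceAdelic (↥(maximalRealSubfield L)) L (IsCMField.complexConj L) N H v).comp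
        (localPiEquiv L (IsCMField.complexConj L) N H v).symm.toMulEquiv.toMonoidHom)).comp (MonoidHom.id ((cmDatum L N H).Local v)))) h (T x) := by
    intro h x
    rw [ContRepresentation.restrict_apply_apply, hT, hT]
    have hfun := family_translate L H v hBinv φ hφ' h x
    have hP' : MemLp (fiberIntegralVec (cmDatum L N H).quotientSubgroup (Measure.count : Measure (cmDatum L N H).quotientSubgroup) (fun z : (cmDatum L N H).Adelic => φ x (((((MonoidHom.id ((cmDatum L N H).Adelic)).comp ((inclPlaceAdelic (↥(maximalRealSubfield L)) L (IsCMField.complexConj L) N H v).comp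
        (localPiEquiv L (IsCMField.complexConj L) N H v).symm.toMulEquiv.toMonoidHom)).comp (MonoidHom.id ((cmDatum L N H).Local v))) h)⁻¹ * z)) : (cmDatum L N H).automorphicQuotient → ℂ) 2 μH := by
      rw [hfun]; exact hP (ρ h x)
    rw [rightRegular_toLp_fiberIntegralVec (cmDatum L N H) μH Measure.count _ (⇑(φ x)) (hP x) hP']
    exact MemLp.toLp_congr _ _ (Eventually.of_forall fun q => by rw [hfun])
  have hvan' : ∀ γ : (cmDatum L N H).Adelic, γ ∈ (cmDatum L N H).quotientSubgroup → γ ≠ 1 → φ u γ = 0 := fun γ hγ hγ1 => by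
    rw [hφ']; exact hvan γ hγ hγ1
  refine ⟨f, φ u, hfc, hfs, hf1, hφ' u, hvan', ?_, ?_, fun w hw k hk => ?_⟩
  · -- `P_{φ_u} ≠ 0`
    refine toLp_fiberIntegralVec_quotientSubgroup_ne_zero (cmDatum L N H) μH Measure.count (φ u) 2 (x := QuotientGroup.mk 1) ?_
    refine ne_of_eq_of_ne (fiberIntegralVec_quotientSubgroup_count_mk (cmDatum L N H) rfl hdisc (φ u) 1) ?_
    have h1val : φ u 1 = B u u := by
      rw [hφ', awayFactor_one L H v, hf1, one_mul, map_one, map_one, Module.End.one_apply]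
    rw [tsum_eq_single (1 : (cmDatum L N H).quotientSubgroup) (fun γ hγ => by
        rw [one_mul]; exact hvan' γ γ.2 (fun h => hγ (Subtype.ext h))),
      OneMemClass.coe_one, one_mul, h1val]
    exact fun h => (hBpos u hu).ne' (by rw [h, Complex.zero_re])
  · -- `R_v(e) P_{φ_u} = P_{φ_u}` (★ p855188 on the intertwiner `T`, `T u = P_{φ_u}`)
    exact integratedOperator_idempotent_apply_intertwiner hadm hsc hZ hBsymm hBpos hBinv ν hu e he _ _ T hinter
  · -- `U(H)(𝒪_w)`-invariance
    have hfun := family_invariant L H v φ hφ' hw hk u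
    have hP' : MemLp (fiberIntegralVec (cmDatum L N H).quotientSubgroup (Measure.count : Measure (cmDatum L N H).quotientSubgroup) (fun z : (cmDatum L N H).Adelic => φ u (((((MonoidHom.id ((cmDatum L N H).Adelic)).comp ((inclPlaceAdelic (↥(maximalRealSubfield L)) L (IsCMField.complexConj L) N H w).comp
        (localPiEquiv L (IsCMField.complexConj L) N H w).symm.toMulEquiv.toMonoidHom)).comp (MonoidHom.id ((cmDatum L N H).Local w))) k)⁻¹ * z)) : (cmDatum L N H).automorphicQuotient → ℂ) 2 μH := by
      rw [hfun]; exact hP u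
    rw [rightRegular_toLp_fiberIntegralVec (cmDatum L N H) μH Measure.count _ (⇑(φ u)) (hP u) hP']
    exact MemLp.toLp_congr _ _ (Eventually.of_forall fun q => by rw [hfun])

end H1

end Summit.HodgeConjecture.HodgeConjecture.Cruxes.H413.K2E1PoincareSeriesH1PackagePoincare

end
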